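import Summits.ResolutionOfSingularities.ResolutionOfSingularities.Theorems.FrobeniusLadderFInjectiveMacaulayficationBrieskornPhamSpecimen
import Summits.ResolutionOfSingularities.ResolutionOfSingularities.Theorems.FrobeniusLadderFInjectiveMacaulayficationF108ClassRow
import Summits.ResolutionOfSingularities.ResolutionOfSingularities.Theorems.FrobeniusLadderFInjectiveMacaulayficationTwoTermFedder
import HarnessLib

/-!
# THE BRIESKORN–PHAM FAMILY `z^c + x^{a₀} + y^{a₁} + u^{a₂} + t^{a₃}` (`2 ≤ c < a₀ ≤ a₁, a₂, a₃`; `a_j ≠ 0` in `k`; `c` FREE): point floor LEGAL and — under the floor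
# inequality `⌊(p−1)/c⌋ + ⌊(p−1)/(a₀−c)⌋ < p−1` — NOT FULL (unconditional), and ★★ THE BRIESKORN–PHAM CONDITIONAL CLASS ROW
# `brieskornPhamRow_of_F108Consumable : F108Consumable k 5 → … → ⟨LEGAL, NOT FULL, CURED⟩` (every multiplicity `c ≥ 2`, every admissible `p`)
# (crux `FInjectiveMacaulayfication` stmt-ResolutionOfSingularities-15315, chain w45a; res-L1-w45a-plan-1 RULING R22.12 (ii); seat res-L1-w45a-stub-1 g14; sequel of
# ✓ `…BrieskornPhamSpecimen`, ✓ `…F108ClassRow` (R22.9 alt-2′), ✓ `…TwoTermFedder` (R22.10 (a)); generalises ✓ `…DiagonalSqRowOfF108` (`c = 2`, equal exponents, `2 ≠ 0`))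

[OURS · L1 W4.5a] Support file (`--supports stmt-ResolutionOfSingularities-15315 --as helper`); def-free; §1–§2 UNCONDITIONAL; §3–§4 CONDITIONAL on the named OURS hypothesis
`F108ClassRow.F108Consumable k 5` (an `@[conjecture]` interface predicate, NOT a Literature fact, NOT in the kernel) carried as an explicit binder `hF`. Nothing of the crux is
proved; no unconditional census row is proved here. AI-written (AI review is weaker than expert review).

Letters: `X 0..X 3 = x,y,u,t`, `X 4 = z`, `f = X4^c + X0^{a₀} + X1^{a₁} + X2^{a₂} + X3^{a₃}`, `v` = the origin; `2 ≤ c < a_j`; the exponent vector is NORMALISED so that `a₀` is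
minimal where the floor certificate is used (`a₀ ≤ a₁, a₂, a₃` — a renaming of `x, y, u, t`, no loss); `(a_j : k) ≠ 0`; NO hypothesis on `c` modulo `p` (wild members
`z^p + Σ x_j^{a_j}`, e.g. the census-shaped double points `z² + x^a + y^a + u^a + t^a` over `𝔽₂`, `a` odd, ARE members).
* §1 `theta` — the five point-blow-up chart identities `θᵢ f = Xᵢ^c·gᵢ` (multiplicity `c` in every chart since `c < a_j`):
  `g_x = z^c + x^{a₀−c} + x^{a₁−c}y^{a₁} + x^{a₂−c}u^{a₂} + x^{a₃−c}t^{a₃}`, …, `g_z = 1 + Σ_j z^{a_j−c}X_j^{a_j}` (symbolic: `a_j = c + d_j`, `ring`); `g_not_mem_span_X`;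
  `constantCoeff_g_zero`; `g_zero_eq_twoTerm` — with `a₀` minimal, `g_x = z^c + x^{a₀−c}·(1 + x^{a₁−a₀}y^{a₁} + x^{a₂−a₀}u^{a₂} + x^{a₃−a₀}t^{a₃})`, a TWO-TERM SHAPE WITH UNIT
  COFACTOR.
* §2 ★ `pointFloor_bp_input_legal` (✓ `PointFloorLegalOfIsolated`; every `c ≥ 2`, primality witness `ω^{a₁} = −1`) and ★ `pointFloor_bp_not_full (p)` — under
  `⌊(p−1)/c⌋ + ⌊(p−1)/(a₀−c)⌋ < p−1` every blowing up of the point floor has a NON-FULL stalk over the closed point (✓ `TwoTermFedder.pointFloor_not_full_of_twoTermChart` with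
  `(c, a₀−c)` at the `x`-chart origin). HAND REMARK (not kernel): at that point the germ is `z^c + x^{a₀−c}·U`, `U` a unit, for which the inequality is EXACTLY Fedderʼs
  non-F-purity criterion (the binomial term `m` of `g_x^{p−1}` survives modulo `𝔪^{[p]}` iff `cm ≤ p−1 ∧ (a₀−c)(p−1−m) ≤ p−1`); for equal exponents every exceptional point
  has this shape (or `z^c + x^{a−c}·w` with `w` a regular parameter, same criterion), so there the inequality is the exact non-FULL criterion of the whole floor; for unequal
  exponents other chart origins can be non-F-pure although the inequality fails (BED W `z³+x⁴+y⁵+u⁵+t⁷`, `p = 3`: the `x`-chart origin `z³ + x·unit` is regular, the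
  `y`-chart origin `z³ + x⁴y + y²·U` is not F-pure) — NOT covered here.
* §3 ★★ `brieskornPhamRow_of_F108Consumable` — `F108Consumable k 5 →` (`k = k̄`, char `p`; `2 ≤ c < a₀ ≤ a₁,a₂,a₃`; `a_j ≠ 0` in `k`; floor inequality) for every blowing up of
  `Spec 𝒪_{X,v}` along the point floor: LEGAL ∧ NOT FULL ∧ CURED — ONE term on ✓ `F108ClassRow.pointFloorRow_of_F108Consumable` with the specimen package
  ✓ `BrieskornPhamSpecimen` (the primality witness comes free from `k = k̄`: `ω^{a₁} = −1`) and §1's elementary data.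
* §4 `diagonalRow_of_F108Consumable'` — the equal-exponent double-point family `z² + Σ x_j^a` (`a ≥ 5`, `a ≠ 0` in `k`) for EVERY `p` INCLUDING `p = 2` and without `Odd a` /
  `(2 : k) ≠ 0` (✓ `DiagonalSqRowOfF108.diagonalRow_of_F108Consumable` needed `2 ≠ 0`): the `c = 2` member, floor inequality by ✓ `TwoTermFedder.floor_half_add_floor_lt`.
[folklore mathematics, OURS as a certificate; cite: Fedder1983, Thm. 1.12; IshiiSingularities2018, Thm. 4.4.23; GortzWedhorn2020, Prop. 13.91 (2)]
-/

-- single-problem summit: the doubled namespace component is forced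
set_option linter.dupNamespace false

noncomputable section

namespace Summit.ResolutionOfSingularities.ResolutionOfSingularities.Theorems.FInjectiveMacaulayfication.BrieskornPhamRowOfF108

open CategoryTheory CategoryTheory.Limits AlgebraicGeometry TopologicalSpace IsLocalRing MvPolynomial
open Literature.AlgebraicGeometry.Resolution
open Summit.ResolutionOfSingularities.ResolutionOfSingularities.Theorems.FInjectiveMacaulayfication
open SliceableCentre

variable (k : Type) [Field k]

/-! ## §1 The strict transforms of the point blow-up (symbolic `c ≤ a_j`) -/

/-- ★ **The chart identities** `θᵢ f = Xᵢ^c · gᵢ` (`c ≤ a_j`). [folklore] -/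
theorem theta (c a₀ a₁ a₂ a₃ : ℕ) (h₀ : c < a₀) (h₁ : c < a₁) (h₂ : c < a₂) (h₃ : c < a₃) (f : MvPolynomial (Fin 5) k)
    (hf : f = X 4 ^ c + X 0 ^ a₀ + X 1 ^ a₁ + X 2 ^ a₂ + X 3 ^ a₃) :
    ∀ i : Fin 5, aeval (fun j : Fin 5 => if j = i then (X i : MvPolynomial (Fin 5) k) else X j * X i) f =
      X i ^ ((fun _ : Fin 5 => c) i) * (![X 4 ^ c + X 0 ^ (a₀ - c) + X 0 ^ (a₁ - c) * X 1 ^ a₁ + X 0 ^ (a₂ - c) * X 2 ^ a₂ + X 0 ^ (a₃ - c) * X 3 ^ a₃,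
        X 4 ^ c + X 1 ^ (a₀ - c) * X 0 ^ a₀ + X 1 ^ (a₁ - c) + X 1 ^ (a₂ - c) * X 2 ^ a₂ + X 1 ^ (a₃ - c) * X 3 ^ a₃,
        X 4 ^ c + X 2 ^ (a₀ - c) * X 0 ^ a₀ + X 2 ^ (a₁ - c) * X 1 ^ a₁ + X 2 ^ (a₂ - c) + X 2 ^ (a₃ - c) * X 3 ^ a₃,
        X 4 ^ c + X 3 ^ (a₀ - c) * X 0 ^ a₀ + X 3 ^ (a₁ - c) * X 1 ^ a₁ + X 3 ^ (a₂ - c) * X 2 ^ a₂ + X 3 ^ (a₃ - c),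
        1 + X 4 ^ (a₀ - c) * X 0 ^ a₀ + X 4 ^ (a₁ - c) * X 1 ^ a₁ + X 4 ^ (a₂ - c) * X 2 ^ a₂ + X 4 ^ (a₃ - c) * X 3 ^ a₃] : Fin 5 → MvPolynomial (Fin 5) k) i := by
  intro i
  subst hf
  obtain ⟨d₀, rfl⟩ : ∃ d, a₀ = c + d := ⟨a₀ - c, by omega⟩
  obtain ⟨d₁, rfl⟩ : ∃ d, a₁ = c + d := ⟨a₁ - c, by omega⟩
  obtain ⟨d₂, rfl⟩ : ∃ d, a₂ = c + d := ⟨a₂ - c, by omega⟩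
  obtain ⟨d₃, rfl⟩ : ∃ d, a₃ = c + d := ⟨a₃ - c, by omega⟩
  simp only [Nat.add_sub_cancel_left]
  fin_cases i <;> simp <;> ring

/-- `gᵢ ∉ (Xᵢ)` for every `i` (`c < a_j`): evaluate at `e_z` (`gᵢ = 1` there, `i ≤ 3`) resp. at `0` (`g_z(0) = 1`). [folklore] -/
theorem g_not_mem_span_X (c a₀ a₁ a₂ a₃ : ℕ) (h₀ : c < a₀) (h₁ : c < a₁) (h₂ : c < a₂) (h₃ : c < a₃) :
    ∀ i : Fin 5, (![X 4 ^ c + X 0 ^ (a₀ - c) + X 0 ^ (a₁ - c) * X 1 ^ a₁ + X 0 ^ (a₂ - c) * X 2 ^ a₂ + X 0 ^ (a₃ - c) * X 3 ^ a₃,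
        X 4 ^ c + X 1 ^ (a₀ - c) * X 0 ^ a₀ + X 1 ^ (a₁ - c) + X 1 ^ (a₂ - c) * X 2 ^ a₂ + X 1 ^ (a₃ - c) * X 3 ^ a₃,
        X 4 ^ c + X 2 ^ (a₀ - c) * X 0 ^ a₀ + X 2 ^ (a₁ - c) * X 1 ^ a₁ + X 2 ^ (a₂ - c) + X 2 ^ (a₃ - c) * X 3 ^ a₃,
        X 4 ^ c + X 3 ^ (a₀ - c) * X 0 ^ a₀ + X 3 ^ (a₁ - c) * X 1 ^ a₁ + X 3 ^ (a₂ - c) * X 2 ^ a₂ + X 3 ^ (a₃ - c),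
        1 + X 4 ^ (a₀ - c) * X 0 ^ a₀ + X 4 ^ (a₁ - c) * X 1 ^ a₁ + X 4 ^ (a₂ - c) * X 2 ^ a₂ + X 4 ^ (a₃ - c) * X 3 ^ a₃] : Fin 5 → MvPolynomial (Fin 5) k) i ∉
      Ideal.span {(X i : MvPolynomial (Fin 5) k)} := by
  have hd0 : a₀ - c ≠ 0 := by omega
  have hd1 : a₁ - c ≠ 0 := by omega
  have hd2 : a₂ - c ≠ 0 := by omega
  have hd3 : a₃ - c ≠ 0 := by omega
  have ha0 : a₀ ≠ 0 := by omega
  have ha1 : a₁ ≠ 0 := by omega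
  have ha2 : a₂ ≠ 0 := by omega
  have ha3 : a₃ ≠ 0 := by omega
  intro i h
  rw [Ideal.mem_span_singleton] at h
  obtain ⟨q, hq⟩ := h
  fin_cases i
  · have := congrArg (MvPolynomial.eval (Pi.single 4 1 : Fin 5 → k)) hq; simp [zero_pow hd0, zero_pow hd1, zero_pow hd2, zero_pow hd3] at this
  · have := congrArg (MvPolynomial.eval (Pi.single 4 1 : Fin 5 → k)) hq; simp [zero_pow hd0, zero_pow hd1, zero_pow hd2, zero_pow hd3] at this
  · have := congrArg (MvPolynomial.eval (Pi.single 4 1 : Fin 5 → k)) hq; simp [zero_pow hd0, zero_pow hd1, zero_pow hd2, zero_pow hd3] at this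
  · have := congrArg (MvPolynomial.eval (Pi.single 4 1 : Fin 5 → k)) hq; simp [zero_pow hd0, zero_pow hd1, zero_pow hd2, zero_pow hd3] at this
  · have := congrArg (MvPolynomial.eval (0 : Fin 5 → k)) hq; simp [zero_pow ha0, zero_pow ha1, zero_pow ha2, zero_pow ha3] at this

/-- `g_x(0) = 0` (`1 ≤ c < a_j`): the origin of the `x`-chart lies on the strict transform. [folklore] -/
theorem constantCoeff_g_zero (c a₀ a₁ a₂ a₃ : ℕ) (hc : 2 ≤ c) (h₀ : c < a₀) (h₁ : c < a₁) (h₂ : c < a₂) (h₃ : c < a₃) :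
    constantCoeff ((![X 4 ^ c + X 0 ^ (a₀ - c) + X 0 ^ (a₁ - c) * X 1 ^ a₁ + X 0 ^ (a₂ - c) * X 2 ^ a₂ + X 0 ^ (a₃ - c) * X 3 ^ a₃,
        X 4 ^ c + X 1 ^ (a₀ - c) * X 0 ^ a₀ + X 1 ^ (a₁ - c) + X 1 ^ (a₂ - c) * X 2 ^ a₂ + X 1 ^ (a₃ - c) * X 3 ^ a₃,
        X 4 ^ c + X 2 ^ (a₀ - c) * X 0 ^ a₀ + X 2 ^ (a₁ - c) * X 1 ^ a₁ + X 2 ^ (a₂ - c) + X 2 ^ (a₃ - c) * X 3 ^ a₃,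
        X 4 ^ c + X 3 ^ (a₀ - c) * X 0 ^ a₀ + X 3 ^ (a₁ - c) * X 1 ^ a₁ + X 3 ^ (a₂ - c) * X 2 ^ a₂ + X 3 ^ (a₃ - c),
        1 + X 4 ^ (a₀ - c) * X 0 ^ a₀ + X 4 ^ (a₁ - c) * X 1 ^ a₁ + X 4 ^ (a₂ - c) * X 2 ^ a₂ + X 4 ^ (a₃ - c) * X 3 ^ a₃] : Fin 5 → MvPolynomial (Fin 5) k) 0) = 0 := by
  simp [constantCoeff_X, zero_pow (by omega : c ≠ 0), zero_pow (by omega : a₀ - c ≠ 0), zero_pow (by omega : a₁ - c ≠ 0), zero_pow (by omega : a₂ - c ≠ 0),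
    zero_pow (by omega : a₃ - c ≠ 0)]

/-- ★ **The `x`-chart strict transform in TWO-TERM SHAPE WITH UNIT COFACTOR** (`a₀` minimal): `g_x = z^c + x^{a₀−c}·(1 + x^{a₁−a₀}y^{a₁} + x^{a₂−a₀}u^{a₂} + x^{a₃−a₀}t^{a₃})`.
[folklore] -/
theorem g_zero_eq_twoTerm (c a₀ a₁ a₂ a₃ : ℕ) (h₀ : c < a₀) (h₀₁ : a₀ ≤ a₁) (h₀₂ : a₀ ≤ a₂) (h₀₃ : a₀ ≤ a₃) :
    (X 4 ^ c + X 0 ^ (a₀ - c) + X 0 ^ (a₁ - c) * X 1 ^ a₁ + X 0 ^ (a₂ - c) * X 2 ^ a₂ + X 0 ^ (a₃ - c) * X 3 ^ a₃ : MvPolynomial (Fin 5) k) =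
      X 4 ^ c + X 0 ^ (a₀ - c) * (1 + X 0 ^ (a₁ - a₀) * X 1 ^ a₁ + X 0 ^ (a₂ - a₀) * X 2 ^ a₂ + X 0 ^ (a₃ - a₀) * X 3 ^ a₃) := by
  rw [show a₁ - c = (a₀ - c) + (a₁ - a₀) by omega, show a₂ - c = (a₀ - c) + (a₂ - a₀) by omega, show a₃ - c = (a₀ - c) + (a₃ - a₀) by omega]
  simp only [pow_add]
  ring

/-! ## §2 Unconditional: the point floor is LEGAL and (under the floor inequality) NOT FULL -/

/-- ★ **THE POINT FLOOR OF THE BRIESKORN–PHAM FAMILY IS A LEGAL INPUT** (`2 ≤ c < a_j`; `a_j ≠ 0` in `k`; a primality witness `ω^{a₁} = −1`; NO hypothesis on `c` mod `p`): for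
every blowing up `g : S′ → Spec 𝒪_{X,v}` along the point floor — centre `≠ ⊥`, supported in the non-regular locus, `S′` regular off the closed fibre, CM everywhere.
[folklore assembly; cite: GortzWedhorn2020, Prop. 13.91 (2)] -/
theorem pointFloor_bp_input_legal (c a₀ a₁ a₂ a₃ : ℕ) (hc : 2 ≤ c) (h₀ : c < a₀) (h₁ : c < a₁) (h₂ : c < a₂) (h₃ : c < a₃)
    (ha₀ : ((a₀ : ℕ) : k) ≠ 0) (ha₁ : ((a₁ : ℕ) : k) ≠ 0) (ha₂ : ((a₂ : ℕ) : k) ≠ 0) (ha₃ : ((a₃ : ℕ) : k) ≠ 0) (ω : k) (hω : ω ^ a₁ + 1 = 0)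
    (f : MvPolynomial (Fin 5) k) (hf : f = X 4 ^ c + X 0 ^ a₀ + X 1 ^ a₁ + X 2 ^ a₂ + X 3 ^ a₃)
    (v : Spec (.of (MvPolynomial (Fin 5) k ⧸ Ideal.span {f})))
    (hv : v.asIdeal = Ideal.span (Set.range (fun j : Fin 5 => Ideal.Quotient.mk (Ideal.span {f}) (X j))))
    (S' : Scheme.{0}) (g : S' ⟶ Spec ((Spec (.of (MvPolynomial (Fin 5) k ⧸ Ideal.span {f}))).presheaf.stalk v))
    (hg : IsBlowup g ((affineBlowup.idealSheaf (Ideal.span (Set.range (fun j : Fin 5 => Ideal.Quotient.mk (Ideal.span {f}) (X j))))).comap ((Spec (.of (MvPolynomial (Fin 5) k ⧸ Ideal.span {f}))).fromSpecStalk v))) :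
    ((affineBlowup.idealSheaf (Ideal.span (Set.range (fun j : Fin 5 => Ideal.Quotient.mk (Ideal.span {f}) (X j))))).comap ((Spec (.of (MvPolynomial (Fin 5) k ⧸ Ideal.span {f}))).fromSpecStalk v)) ≠ ⊥ ∧
    (((((affineBlowup.idealSheaf (Ideal.span (Set.range (fun j : Fin 5 => Ideal.Quotient.mk (Ideal.span {f}) (X j))))).comap ((Spec (.of (MvPolynomial (Fin 5) k ⧸ Ideal.span {f}))).fromSpecStalk v))).support :
        Set (Spec ((Spec (.of (MvPolynomial (Fin 5) k ⧸ Ideal.span {f}))).presheaf.stalk v))) ⊆ (Scheme.regularLocus (Spec ((Spec (.of (MvPolynomial (Fin 5) k ⧸ Ideal.span {f}))).presheaf.stalk v)))ᶜ) ∧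
    (∀ s : S', g.base s ≠ closedPoint ((Spec (.of (MvPolynomial (Fin 5) k ⧸ Ideal.span {f}))).presheaf.stalk v) → s ∈ Scheme.regularLocus S') ∧
    (∀ s : S', CMCl (S'.presheaf.stalk s)) := by
  have hreg : ∀ y : Spec (.of (MvPolynomial (Fin 5) k ⧸ Ideal.span {f})), y ⤳ v → y ≠ v →
      y ∈ Scheme.regularLocus (Spec (.of (MvPolynomial (Fin 5) k ⧸ Ideal.span {f}))) := by
    intro y hy hne
    refine FermatCubicConeGerm.mem_regularLocus_Spec_of_isRegularLocalRing y
      (BrieskornPhamSpecimen.regular_off_vertex k c a₀ a₁ a₂ a₃ hc h₀ h₁ h₂ h₃ ha₀ ha₁ ha₂ ha₃ f hf y.asIdeal fun hle => hne ?_)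
    have hyv : y.asIdeal ≤ v.asIdeal := (PrimeSpectrum.le_iff_specializes y v).mpr hy
    exact PrimeSpectrum.ext (le_antisymm hyv (hv ▸ hle))
  exact PointFloorLegalOfIsolated.pointFloor_input_legal k f (BrieskornPhamSpecimen.prime_f k c a₀ a₁ a₂ a₃ hc h₂ h₃ ha₀ ω hω f hf) (by norm_num) (fun _ : Fin 5 => c) _
    (theta k c a₀ a₁ a₂ a₃ h₀ h₁ h₂ h₃ f hf) (BrieskornPhamSpecimen.f_not_mem_span_X k c a₀ a₁ a₂ a₃ hc h₀ h₁ h₂ h₃ f hf) (g_not_mem_span_X k c a₀ a₁ a₂ a₃ h₀ h₁ h₂ h₃) v hv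
    (BrieskornPhamSpecimen.vertex_not_mem_regularLocus k c a₀ a₁ a₂ a₃ hc h₀ h₁ h₂ h₃ ha₀ ω hω f hf v hv) hreg S' g hg

/-- ★ **THE POINT FLOOR OF THE BRIESKORN–PHAM FAMILY IS NOT FULL UNDER THE FLOOR INEQUALITY** `⌊(p−1)/c⌋ + ⌊(p−1)/(a₀−c)⌋ < p−1` (`a₀` the minimal exponent; `a₀ ≠ 0` in `k` and a
primality witness `ω^{a₁} = −1`): for every blowing up along the point floor some stalk over the closed point is NOT `FullCl p` — the `x`-chart strict transform is
`z^c + x^{a₀−c}·(unit)` (§1 `g_zero_eq_twoTerm`, ✓ `TwoTermFedder.pointFloor_not_full_of_twoTermChart`). [OURS · p-uniform negative certificate; cite: Fedder1983, Thm. 1.12] -/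
theorem pointFloor_bp_not_full (p : ℕ) [Fact p.Prime] [CharP k p] (c a₀ a₁ a₂ a₃ : ℕ) (hc : 2 ≤ c) (h₀ : c < a₀) (h₀₁ : a₀ ≤ a₁) (h₀₂ : a₀ ≤ a₂) (h₀₃ : a₀ ≤ a₃)
    (ha₀ : ((a₀ : ℕ) : k) ≠ 0) (ω : k) (hω : ω ^ a₁ + 1 = 0) (hab : (p - 1) / c + (p - 1) / (a₀ - c) < p - 1)
    (f : MvPolynomial (Fin 5) k) (hf : f = X 4 ^ c + X 0 ^ a₀ + X 1 ^ a₁ + X 2 ^ a₂ + X 3 ^ a₃)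
    (v : Spec (.of (MvPolynomial (Fin 5) k ⧸ Ideal.span {f})))
    (hv : v.asIdeal = Ideal.span (Set.range (fun j : Fin 5 => Ideal.Quotient.mk (Ideal.span {f}) (X j))))
    (S' : Scheme.{0}) (g : S' ⟶ Spec ((Spec (.of (MvPolynomial (Fin 5) k ⧸ Ideal.span {f}))).presheaf.stalk v))
    (hg : IsBlowup g ((affineBlowup.idealSheaf (Ideal.span (Set.range (fun j : Fin 5 => Ideal.Quotient.mk (Ideal.span {f}) (X j))))).comap ((Spec (.of (MvPolynomial (Fin 5) k ⧸ Ideal.span {f}))).fromSpecStalk v))) :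
    ∃ s : S', g.base s = closedPoint ((Spec (.of (MvPolynomial (Fin 5) k ⧸ Ideal.span {f}))).presheaf.stalk v) ∧ ¬ FullCl p (S'.presheaf.stalk s) :=
  TwoTermFedder.pointFloor_not_full_of_twoTermChart k p f (BrieskornPhamSpecimen.prime_f k c a₀ a₁ a₂ a₃ hc (by omega) (by omega) ha₀ ω hω f hf) (fun _ : Fin 5 => c) _
    (theta k c a₀ a₁ a₂ a₃ h₀ (by omega) (by omega) (by omega) f hf) (BrieskornPhamSpecimen.f_not_mem_span_X k c a₀ a₁ a₂ a₃ hc h₀ (by omega) (by omega) (by omega) f hf)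
    (g_not_mem_span_X k c a₀ a₁ a₂ a₃ h₀ (by omega) (by omega) (by omega)) (BrieskornPhamSpecimen.constantCoeff_f k c a₀ a₁ a₂ a₃ hc h₀ (by omega) (by omega) (by omega) f hf)
    0 4 0 c (a₀ - c) (by omega) (by omega) hab (1 + X 0 ^ (a₁ - a₀) * X 1 ^ a₁ + X 0 ^ (a₂ - a₀) * X 2 ^ a₂ + X 0 ^ (a₃ - a₀) * X 3 ^ a₃)
    (by rw [Matrix.cons_val_zero]; exact g_zero_eq_twoTerm k c a₀ a₁ a₂ a₃ h₀ h₀₁ h₀₂ h₀₃) v hv S' g hg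

/-! ## §3 ★★ The conditional class row over the whole family -/

/-- ★★ **THE BRIESKORN–PHAM CONDITIONAL CLASS ROW**: CONDITIONAL on the named OURS hypothesis `F108ClassRow.F108Consumable k 5`, for `k = k̄` of characteristic `p`, every
multiplicity `c ≥ 2` (NO hypothesis on `c` mod `p`), exponents `c < a₀ ≤ a₁, a₂, a₃` with `a_j ≠ 0` in `k`, the floor inequality `⌊(p−1)/c⌋ + ⌊(p−1)/(a₀−c)⌋ < p−1`, and EVERY
blowing up `g : S′ → Spec 𝒪_{X,v}` of the germ of `X = V(z^c + x^{a₀} + y^{a₁} + u^{a₂} + t^{a₃})` at the origin along the point floor: (LEGAL) centre `≠ ⊥`, supported in the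
non-regular locus, `S′` regular off the closed fibre, CM everywhere; (NOT FULL) some stalk over the closed point is not `FullCl p`; (CURED) there is `𝓚 ≠ ⊥` on `S′` supported
over the closed point all of whose blowings up are FULL everywhere. ONE term on ✓ `F108ClassRow.pointFloorRow_of_F108Consumable`; the primality witness `ω^{a₁} = −1` exists as
`k = k̄`. Members: the diagonal double points ✓ `DiagonalSqRowOfF108` (now also at `p = 2`), B9, wild triple points `z³ + Σx^a` at `p = 3`, quadruple points `z⁴ + Σx^a` at
`p = 2` (`a` odd `≥ 7`), every tame `z^c + …`. [OURS · conditional class row; cite: IshiiSingularities2018, Thm. 4.4.23; Fedder1983, Thm. 1.12] -/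
theorem brieskornPhamRow_of_F108Consumable (p : ℕ) [Fact p.Prime] [IsAlgClosed k] [CharP k p] (hF : F108ClassRow.F108Consumable k 5)
    (c a₀ a₁ a₂ a₃ : ℕ) (hc : 2 ≤ c) (h₀ : c < a₀) (h₀₁ : a₀ ≤ a₁) (h₀₂ : a₀ ≤ a₂) (h₀₃ : a₀ ≤ a₃)
    (ha₀ : ((a₀ : ℕ) : k) ≠ 0) (ha₁ : ((a₁ : ℕ) : k) ≠ 0) (ha₂ : ((a₂ : ℕ) : k) ≠ 0) (ha₃ : ((a₃ : ℕ) : k) ≠ 0) (hab : (p - 1) / c + (p - 1) / (a₀ - c) < p - 1)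
    (f : MvPolynomial (Fin 5) k) (hf : f = X 4 ^ c + X 0 ^ a₀ + X 1 ^ a₁ + X 2 ^ a₂ + X 3 ^ a₃)
    (v : Spec (.of (MvPolynomial (Fin 5) k ⧸ Ideal.span {f})))
    (hv : v.asIdeal = Ideal.span (Set.range (fun j : Fin 5 => Ideal.Quotient.mk (Ideal.span {f}) (X j))))
    (S' : Scheme.{0}) (g : S' ⟶ Spec ((Spec (.of (MvPolynomial (Fin 5) k ⧸ Ideal.span {f}))).presheaf.stalk v))
    (hg : IsBlowup g ((affineBlowup.idealSheaf (Ideal.span (Set.range (fun j : Fin 5 => Ideal.Quotient.mk (Ideal.span {f}) (X j))))).comap ((Spec (.of (MvPolynomial (Fin 5) k ⧸ Ideal.span {f}))).fromSpecStalk v))) :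
    (((affineBlowup.idealSheaf (Ideal.span (Set.range fun j : Fin 5 => Ideal.Quotient.mk (Ideal.span {f}) (X j)))).comap
        ((Spec (.of (MvPolynomial (Fin 5) k ⧸ Ideal.span {f}))).fromSpecStalk v)) ≠ ⊥ ∧
      ((((affineBlowup.idealSheaf (Ideal.span (Set.range fun j : Fin 5 => Ideal.Quotient.mk (Ideal.span {f}) (X j)))).comap
        ((Spec (.of (MvPolynomial (Fin 5) k ⧸ Ideal.span {f}))).fromSpecStalk v)).support :
          Set (Spec ((Spec (.of (MvPolynomial (Fin 5) k ⧸ Ideal.span {f}))).presheaf.stalk v))) ⊆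
        (Scheme.regularLocus (Spec ((Spec (.of (MvPolynomial (Fin 5) k ⧸ Ideal.span {f}))).presheaf.stalk v)))ᶜ) ∧
      (∀ s : S', g.base s ≠ closedPoint _ → s ∈ Scheme.regularLocus S') ∧ (∀ s : S', CMCl (S'.presheaf.stalk s))) ∧
    (∃ s : S', g.base s = closedPoint _ ∧ ¬ FullCl p (S'.presheaf.stalk s)) ∧
    (∃ 𝓚 : S'.IdealSheafData, 𝓚 ≠ ⊥ ∧ (∀ s ∈ (𝓚.support : Set S'), g.base s = closedPoint _) ∧
      ∀ (S'' : Scheme.{0}) (π : S'' ⟶ S'), IsBlowup π 𝓚 → ∀ s : S'', FullCl p (S''.presheaf.stalk s)) := by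
  -- the primality witness: `ω^{a₁} = −1` in `k = k̄`
  obtain ⟨ω, hω'⟩ := IsAlgClosed.exists_pow_nat_eq (-1 : k) (n := a₁) (by omega)
  have hω : ω ^ a₁ + 1 = 0 := by rw [hω']; ring
  have hprime := BrieskornPhamSpecimen.prime_f k c a₀ a₁ a₂ a₃ hc (by omega) (by omega) ha₀ ω hω f hf
  exact F108ClassRow.pointFloorRow_of_F108Consumable k p hF (by norm_num) f hprime
    (BrieskornPhamSpecimen.convenient_f k c a₀ a₁ a₂ a₃ hc h₀ (by omega) (by omega) (by omega) f hf)
    (BrieskornPhamSpecimen.weaklyNondegenerate_f k c a₀ a₁ a₂ a₃ ha₀ ha₁ ha₂ ha₃ f hf)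
    (BrieskornPhamSpecimen.mk_X_ne_zero k c a₀ a₁ a₂ a₃ hc h₀ (by omega) (by omega) (by omega) ha₀ ω hω f hf)
    (fun x hx => BrieskornPhamSpecimen.regular_off_vertex k c a₀ a₁ a₂ a₃ hc h₀ (by omega) (by omega) (by omega) ha₀ ha₁ ha₂ ha₃ f hf x.asIdeal hx)
    (fun _ : Fin 5 => c) _ (theta k c a₀ a₁ a₂ a₃ h₀ (by omega) (by omega) (by omega) f hf)
    (BrieskornPhamSpecimen.f_not_mem_span_X k c a₀ a₁ a₂ a₃ hc h₀ (by omega) (by omega) (by omega) f hf) (g_not_mem_span_X k c a₀ a₁ a₂ a₃ h₀ (by omega) (by omega) (by omega))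
    (BrieskornPhamSpecimen.constantCoeff_f k c a₀ a₁ a₂ a₃ hc h₀ (by omega) (by omega) (by omega) f hf) 0 (constantCoeff_g_zero k c a₀ a₁ a₂ a₃ hc h₀ (by omega) (by omega) (by omega))
    (by
      rw [Matrix.cons_val_zero, g_zero_eq_twoTerm k c a₀ a₁ a₂ a₃ h₀ h₀₁ h₀₂ h₀₃]
      exact TwoTermFedder.twoTerm_pow_mem_frobeniusPower k p 4 0 c (a₀ - c) (by omega) (by omega) hab _)
    v hv (BrieskornPhamSpecimen.vertex_not_mem_regularLocus k c a₀ a₁ a₂ a₃ hc h₀ (by omega) (by omega) (by omega) ha₀ ω hω f hf v hv) S' g hg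

/-! ## §4 The equal-exponent double-point member at EVERY prime, `p = 2` included -/

/-- **The diagonal double-point family `z² + x^a + y^a + u^a + t^a` (`a ≥ 5`, `a ≠ 0` in `k`) — conditional row for EVERY `p`, without `(2 : k) ≠ 0` and without `Odd a`**
(✓ `DiagonalSqRowOfF108.diagonalRow_of_F108Consumable` needed `2 ≠ 0`): the `c = 2` member of §3; the floor inequality `⌊(p−1)/2⌋ + ⌊(p−1)/(a−2)⌋ < p−1` holds for every `p`
(✓ `TwoTermFedder.floor_half_add_floor_lt`). At `p = 2` these are WILD double points `z² + Σ x_j^a` over `𝔽̄₂` (`a` odd), the census's own `(4,2)` ground.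
[OURS · conditional class row; cite: IshiiSingularities2018, Thm. 4.4.23; Fedder1983, Thm. 1.12] -/
theorem diagonalRow_of_F108Consumable' (p : ℕ) [Fact p.Prime] [IsAlgClosed k] [CharP k p] (hF : F108ClassRow.F108Consumable k 5)
    (a : ℕ) (ha5 : 5 ≤ a) (haK : ((a : ℕ) : k) ≠ 0) (f : MvPolynomial (Fin 5) k)
    (hf : f = X 4 ^ 2 + X 0 ^ a + X 1 ^ a + X 2 ^ a + X 3 ^ a)
    (v : Spec (.of (MvPolynomial (Fin 5) k ⧸ Ideal.span {f})))
    (hv : v.asIdeal = Ideal.span (Set.range (fun j : Fin 5 => Ideal.Quotient.mk (Ideal.span {f}) (X j))))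
    (S' : Scheme.{0}) (g : S' ⟶ Spec ((Spec (.of (MvPolynomial (Fin 5) k ⧸ Ideal.span {f}))).presheaf.stalk v))
    (hg : IsBlowup g ((affineBlowup.idealSheaf (Ideal.span (Set.range (fun j : Fin 5 => Ideal.Quotient.mk (Ideal.span {f}) (X j))))).comap ((Spec (.of (MvPolynomial (Fin 5) k ⧸ Ideal.span {f}))).fromSpecStalk v))) :
    (((affineBlowup.idealSheaf (Ideal.span (Set.range fun j : Fin 5 => Ideal.Quotient.mk (Ideal.span {f}) (X j)))).comap
        ((Spec (.of (MvPolynomial (Fin 5) k ⧸ Ideal.span {f}))).fromSpecStalk v)) ≠ ⊥ ∧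
      ((((affineBlowup.idealSheaf (Ideal.span (Set.range fun j : Fin 5 => Ideal.Quotient.mk (Ideal.span {f}) (X j)))).comap
        ((Spec (.of (MvPolynomial (Fin 5) k ⧸ Ideal.span {f}))).fromSpecStalk v)).support :
          Set (Spec ((Spec (.of (MvPolynomial (Fin 5) k ⧸ Ideal.span {f}))).presheaf.stalk v))) ⊆
        (Scheme.regularLocus (Spec ((Spec (.of (MvPolynomial (Fin 5) k ⧸ Ideal.span {f}))).presheaf.stalk v)))ᶜ) ∧
      (∀ s : S', g.base s ≠ closedPoint _ → s ∈ Scheme.regularLocus S') ∧ (∀ s : S', CMCl (S'.presheaf.stalk s))) ∧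
    (∃ s : S', g.base s = closedPoint _ ∧ ¬ FullCl p (S'.presheaf.stalk s)) ∧
    (∃ 𝓚 : S'.IdealSheafData, 𝓚 ≠ ⊥ ∧ (∀ s ∈ (𝓚.support : Set S'), g.base s = closedPoint _) ∧
      ∀ (S'' : Scheme.{0}) (π : S'' ⟶ S'), IsBlowup π 𝓚 → ∀ s : S'', FullCl p (S''.presheaf.stalk s)) :=
  brieskornPhamRow_of_F108Consumable k p hF 2 a a a a le_rfl (by omega) le_rfl le_rfl le_rfl haK haK haK haK
    (TwoTermFedder.floor_half_add_floor_lt p (a - 2) (Fact.out : p.Prime).two_le (by omega)) f hf v hv S' g hg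

end Summit.ResolutionOfSingularities.ResolutionOfSingularities.Theorems.FInjectiveMacaulayfication.BrieskornPhamRowOfF108

end
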